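import Literature.Analysis.FunctionSpaces.LittlewoodPaleyBernsteinProofs
import HarnessLib

/-!
# Discharged facts: the dyadic partition of unity, block identities, `Ṡ_j φ → φ`

`Literature.Analysis.FunctionSpaces.LittlewoodPaley` records as named facts (`Prop`-valued `def`s,
Bahouri–Chemin–Danchin 2011, Prop. 2.10, (2.4), (2.5), Prop. 2.12) the elementary algebra of the
homogeneous Littlewood–Paley decomposition. Using the support facts
`Literature.Analysis.FunctionSpaces.dyadicSymbol_apply_of_norm_le_holds` / `Literature.Analysis.FunctionSpaces.dyadicSymbol_apply_of_le_norm_holds` of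
`LittlewoodPaleyBernsteinProofs.lean`, this file proves the remaining ones of that group:

* `Literature.finite_support_dyadicSymbol_holds : finite_support_dyadicSymbol` — at the dyadic scale
  `n` of `ξ ≠ 0` (`2^n ≤ ‖ξ‖ < 2^{n+1}`, `Literature.Analysis.FunctionSpaces.exists_zpow_le_norm_lt`) only `φ_n(ξ)`, `φ_{n+1}(ξ)`
  can be nonzero (`Literature.Analysis.FunctionSpaces.dyadicSymbol_apply_eq_zero_of_scale`);
* `Literature.sum_dyadicSymbol_holds : sum_dyadicSymbol` — `∑_j φ_j(ξ) = 1` for `ξ ≠ 0`: the two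
  surviving terms telescope to `χ(2^{-(n+1)}ξ) - χ(2^{1-n}ξ) = 1 - 0`;
* `Literature.lpBlock_eq_sub_holds : lpBlock_eq_sub` — `Δ̇_j = Ṡ_j - Ṡ_{j-1}` (additivity of
  `g ↦ g(D)` in the symbol, `Literature.Analysis.FunctionSpaces.fourierMultiplierCLM_sub`);
* `Literature.lpBlock_lpBlock_eq_zero_of_lt_holds : lpBlock_lpBlock_eq_zero_of_lt` — `Δ̇_j Δ̇_{j'} = 0`
  for `|j - j'| ≥ 2` (the symbols have disjoint supports,
  `Literature.Analysis.FunctionSpaces.dyadicSymbol_mul_dyadicSymbol_eq_zero`);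
* `Literature.tendsto_lowFreqCutoff_atTop_holds : tendsto_lowFreqCutoff_atTop` (BCD Prop. 2.12) —
  `Ṡ_j φ → φ` in `𝓢'(E, F)` as `j → +∞` for Schwartz `φ`: tested against `ψ`,
  `⟨Ṡ_j φ, ψ⟩ = ∫ 𝓕(χ(2^{-j}·) 𝓕⁻ψ) • φ`, and `𝓕(χ(2^{-j}·) 𝓕⁻ψ)(x) → 𝓕𝓕⁻ψ(x) = ψ(x)` boundedly
  (`≤ ‖𝓕⁻ψ‖_{L¹}`, since `0 ≤ χ ≤ 1` and `χ(2^{-j}ξ) → χ(0) = 1`), so two dominated convergences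
  give `⟨Ṡ_j φ, ψ⟩ → ∫ ψ • φ = ⟨φ, ψ⟩`.

## References

* H. Bahouri, J.-Y. Chemin, R. Danchin, *Fourier Analysis and Nonlinear Partial Differential
  Equations*, Grundlehren 343, Springer (2011), doi:10.1007/978-3-642-16830-7, Prop. 2.10 and
  (2.3) (dyadic partition of unity), (2.4) (quasi-orthogonality), (2.5) (`Δ̇_j = Ṡ_{j+1} - Ṡ_j`),
  Prop. 2.12 (convergence of the decomposition). [cite: BahouriCheminDanchin2011, Prop. 2.10 and Prop. 2.12]
-/

open MeasureTheory FourierTransform RealInnerProductSpace TemperedDistribution Filter Topology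
open scoped SchwartzMap ENNReal NNReal

noncomputable section

namespace Literature.Analysis.FunctionSpaces

/-! ## Local finiteness and the partition of unity -/

section Partition

variable {E : Type*} [NormedAddCommGroup E]

/-- The dyadic scale of a nonzero vector: `2^n ≤ ‖ξ‖ < 2^{n+1}` for some `n ∈ ℤ`
(Mathlib's `exists_mem_Ico_zpow`). [folklore] -/
theorem exists_zpow_le_norm_lt {ξ : E} (hξ : ξ ≠ 0) :
    ∃ n : ℤ, (2 : ℝ) ^ n ≤ ‖ξ‖ ∧ ‖ξ‖ < (2 : ℝ) ^ (n + 1) := by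
  obtain ⟨n, hn⟩ := exists_mem_Ico_zpow (norm_pos_iff.2 hξ) one_lt_two
  exact ⟨n, hn.1, hn.2⟩

variable [InnerProductSpace ℝ E]

/-- At scale `n` (`2^n ≤ ‖ξ‖ < 2^{n+1}`) only `φ_n(ξ)` and `φ_{n+1}(ξ)` can be nonzero:
`φ_j(ξ) = 0` for `j ∉ {n, n+1}` — for `j ≤ n - 1`, `2^{j+1} ≤ 2^n ≤ ‖ξ‖`; for `j ≥ n + 2`,
`‖ξ‖ < 2^{n+1} ≤ 2^{j-1}` (BCD Prop. 2.10). [folklore] -/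
theorem dyadicSymbol_apply_eq_zero_of_scale {ξ : E} {n : ℤ} (h₁ : (2 : ℝ) ^ n ≤ ‖ξ‖)
    (h₂ : ‖ξ‖ < (2 : ℝ) ^ (n + 1)) {j : ℤ} (hj : j ≠ n) (hj' : j ≠ n + 1) :
    dyadicSymbol j ξ = 0 := by
  have hmono : StrictMono fun k : ℤ => (2 : ℝ) ^ k := zpow_right_strictMono₀ one_lt_two
  rcases lt_or_gt_of_ne hj with hlt | hgt
  · refine dyadicSymbol_apply_of_le_norm_holds (j := j) (le_trans ?_ h₁)
    exact hmono.monotone (show j + 1 ≤ n by omega)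
  · refine dyadicSymbol_apply_of_norm_le_holds (j := j) (h₂.le.trans ?_)
    exact hmono.monotone (show n + 1 ≤ j - 1 by omega)

/-- Discharge of the named fact `finite_support_dyadicSymbol` (BCD Prop. 2.10): for `ξ ≠ 0`
only finitely many — at most the two `j ∈ {n, n+1}`, `n` the dyadic scale of `ξ` — of the
`φ_j(ξ)` are nonzero. [cite: BahouriCheminDanchin2011, Prop. 2.10] -/
theorem finite_support_dyadicSymbol_holds : finite_support_dyadicSymbol (E := E) := by
  intro ξ hξ
  obtain ⟨n, h₁, h₂⟩ := exists_zpow_le_norm_lt hξ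
  refine (Set.toFinite ({n, n + 1} : Set ℤ)).subset fun j hj => ?_
  by_contra hmem
  simp only [Set.mem_insert_iff, Set.mem_singleton_iff, not_or] at hmem
  exact hj (dyadicSymbol_apply_eq_zero_of_scale h₁ h₂ hmem.1 hmem.2)

/-- Discharge of the named fact `sum_dyadicSymbol` (BCD Prop. 2.10, (2.3)): `∑_{j ∈ ℤ} φ_j(ξ) = 1`
for `ξ ≠ 0`. At the dyadic scale `n` of `ξ` the series has the two terms `j = n, n + 1`, which
telescope to `χ(2^{-(n+1)}ξ) - χ(2^{1-n}ξ) = 1 - 0` (`‖2^{-(n+1)}ξ‖ ≤ 1`, `‖2^{1-n}ξ‖ ≥ 2`). [cite: BahouriCheminDanchin2011, Prop. 2.10] -/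
theorem sum_dyadicSymbol_holds : sum_dyadicSymbol (E := E) := by
  intro ξ hξ
  obtain ⟨n, h₁, h₂⟩ := exists_zpow_le_norm_lt hξ
  have h2 : (0 : ℝ) < 2 := two_pos
  have hne : n ≠ n + 1 := by omega
  have hsum : ∑ j ∈ ({n, n + 1} : Finset ℤ), dyadicSymbol j ξ = 1 := by
    rw [Finset.sum_pair hne]
    simp only [dyadicSymbol]
    have hA : dyadicCutoff E (((2 : ℝ) ^ (-(n + 1))) • ξ) = 1 := by
      apply dyadicCutoff_apply_of_norm_le_one
      rw [norm_two_zpow_smul]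
      calc (2 : ℝ) ^ (-(n + 1)) * ‖ξ‖ ≤ (2 : ℝ) ^ (-(n + 1)) * (2 : ℝ) ^ (n + 1) :=
            mul_le_mul_of_nonneg_left h₂.le (zpow_nonneg h2.le _)
        _ = 1 := by rw [← zpow_add₀ h2.ne']; simp
    have hB : dyadicCutoff E (((2 : ℝ) ^ (1 - n)) • ξ) = 0 := by
      apply dyadicCutoff_apply_of_two_le_norm
      rw [norm_two_zpow_smul]
      calc (2 : ℝ) = (2 : ℝ) ^ (1 - n) * (2 : ℝ) ^ n := by
            rw [← zpow_add₀ h2.ne', show 1 - n + n = 1 by ring, zpow_one]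
        _ ≤ (2 : ℝ) ^ (1 - n) * ‖ξ‖ := mul_le_mul_of_nonneg_left h₁ (zpow_nonneg h2.le _)
    rw [show (1 : ℤ) - (n + 1) = -n by ring, hA, hB]
    push_cast
    ring
  rw [← hsum]
  refine hasSum_sum_of_ne_finset_zero fun j hj => ?_
  simp only [Finset.mem_insert, Finset.mem_singleton, not_or] at hj
  exact dyadicSymbol_apply_eq_zero_of_scale h₁ h₂ hj.1 hj.2

/-- The product of two dyadic symbols two or more scales apart vanishes identically: the
annuli `2^{j-1} < ‖ξ‖ < 2^{j+1}` and `2^{j'-1} < ‖ξ‖ < 2^{j'+1}` are disjoint for `|j - j'| ≥ 2`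
(BCD (2.4)). [folklore] -/
theorem dyadicSymbol_mul_dyadicSymbol_eq_zero {j j' : ℤ} (h : 1 < |j - j'|) :
    (dyadicSymbol j' : E → ℂ) * dyadicSymbol j = 0 := by
  have hmono : StrictMono fun k : ℤ => (2 : ℝ) ^ k := zpow_right_strictMono₀ one_lt_two
  have hcases : j' + 2 ≤ j ∨ j + 2 ≤ j' := by
    rcases le_or_gt 0 (j - j') with h0 | h0
    · rw [abs_of_nonneg h0] at h; left; omega
    · rw [abs_of_neg h0] at h; right; omega
  funext ξ
  simp only [Pi.mul_apply, Pi.zero_apply]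
  rcases hcases with hjj | hjj
  · rcases le_or_gt ‖ξ‖ ((2 : ℝ) ^ (j - 1)) with hξ | hξ
    · rw [dyadicSymbol_apply_of_norm_le_holds (j := j) hξ, mul_zero]
    · have hle : (2 : ℝ) ^ (j' + 1) ≤ ‖ξ‖ := le_trans (hmono.monotone (by omega)) hξ.le
      rw [dyadicSymbol_apply_of_le_norm_holds (j := j') hle, zero_mul]
  · rcases le_or_gt ‖ξ‖ ((2 : ℝ) ^ (j' - 1)) with hξ | hξ
    · rw [dyadicSymbol_apply_of_norm_le_holds (j := j') hξ, zero_mul]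
    · have hle : (2 : ℝ) ^ (j + 1) ≤ ‖ξ‖ := le_trans (hmono.monotone (by omega)) hξ.le
      rw [dyadicSymbol_apply_of_le_norm_holds (j := j) hle, mul_zero]

end Partition

/-! ## Block identities -/

section Blocks

variable {E F : Type*} [NormedAddCommGroup E] [InnerProductSpace ℝ E] [FiniteDimensional ℝ E]
  [MeasurableSpace E] [BorelSpace E] [NormedAddCommGroup F] [NormedSpace ℂ F]

/-- Additivity of Mathlib's Fourier multiplier operator on `𝓢'` in the symbol, subtraction form,
for symbols of temperate growth (twin of `Literature.Analysis.FunctionSpaces.fourierMultiplierCLM_add`; from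
`TemperedDistribution.smulLeftCLM_sub`). [folklore] -/
theorem fourierMultiplierCLM_sub {g₁ g₂ : E → ℂ} (hg₁ : g₁.HasTemperateGrowth)
    (hg₂ : g₂.HasTemperateGrowth) :
    (fourierMultiplierCLM F (g₁ - g₂) : 𝓢'(E, F) →L[ℂ] 𝓢'(E, F)) =
      fourierMultiplierCLM F g₁ - fourierMultiplierCLM F g₂ := by
  ext1 f
  show fourierMultiplierCLM F (g₁ - g₂) f = fourierMultiplierCLM F g₁ f - fourierMultiplierCLM F g₂ f
  rw [fourierMultiplierCLM_apply, fourierMultiplierCLM_apply, fourierMultiplierCLM_apply,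
    smulLeftCLM_sub hg₁ hg₂,
    show (smulLeftCLM F g₁ - smulLeftCLM F g₂) (𝓕 f) = smulLeftCLM F g₁ (𝓕 f) - smulLeftCLM F g₂ (𝓕 f)
      from rfl,
    sub_eq_add_neg, FourierTransform.fourierInv_add, FourierTransform.fourierInv_neg, ← sub_eq_add_neg]

/-- Discharge of the named fact `lpBlock_eq_sub` (BCD (2.5), up to the index shift recorded in
`LittlewoodPaley.lean`): `Δ̇_j = Ṡ_j - Ṡ_{j-1}` on `𝓢'(E, F)`, from `φ_j = χ(2^{-j}·) - χ(2^{1-j}·)`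
(`Literature.Analysis.FunctionSpaces.dyadicSymbol_eq_sub`) and the additivity of `g ↦ g(D)`. [cite: BahouriCheminDanchin2011, (2.5)] -/
theorem lpBlock_eq_sub_holds : lpBlock_eq_sub (E := E) (F := F) := by
  intro j
  change fourierMultiplierCLM F (dyadicSymbol (E := E) j) =
    fourierMultiplierCLM F (lowFreqSymbol (E := E) j) - fourierMultiplierCLM F (lowFreqSymbol (j - 1))
  rw [dyadicSymbol_eq_sub,
    fourierMultiplierCLM_sub (hasTemperateGrowth_lowFreqSymbol j) (hasTemperateGrowth_lowFreqSymbol _)]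

/-- Discharge of the named fact `lpBlock_lpBlock_eq_zero_of_lt` (BCD (2.4), quasi-orthogonality
of the dyadic blocks): `Δ̇_j Δ̇_{j'} = 0` for `|j - j'| ≥ 2`, since `Δ̇_j Δ̇_{j'} = (φ_{j'} φ_j)(D)`
(`Literature.Analysis.FunctionSpaces.lpBlock_lpBlock`) and the product of the symbols vanishes. [cite: BahouriCheminDanchin2011, (2.4)] -/
theorem lpBlock_lpBlock_eq_zero_of_lt_holds : lpBlock_lpBlock_eq_zero_of_lt (E := E) (F := F) := by
  intro j j' h u
  rw [lpBlock_lpBlock, dyadicSymbol_mul_dyadicSymbol_eq_zero h]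
  have : ((0 : E → ℂ)) = fun _ => (0 : ℂ) := rfl
  rw [this, fourierMultiplierCLM_const]
  simp

end Blocks

/-! ## Convergence of the low-frequency cut-offs: `Ṡ_j φ → φ` (BCD Prop. 2.12) -/

section LowFreqSymbol

variable {E : Type*} [NormedAddCommGroup E] [InnerProductSpace ℝ E]

/-- `2^{-j} → 0` as `j → +∞` along the integers. [folklore] -/
theorem tendsto_two_zpow_neg_atTop : Tendsto (fun j : ℤ => (2 : ℝ) ^ (-j)) atTop (𝓝 0) := by
  have h := (tendsto_rpow_atBot_of_base_gt_one 2 one_lt_two).comp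
    ((tendsto_intCast_atBot_iff (R := ℝ)).2 tendsto_neg_atTop_atBot)
  refine h.congr fun j => ?_
  simp only [Function.comp_apply, Int.cast_neg, zpow_neg]
  rw [Real.rpow_neg zero_le_two, Real.rpow_intCast]

/-- `χ(2^{-j} ξ) → χ(0) = 1` as `j → +∞` (continuity of the cut-off). [folklore] -/
theorem tendsto_lowFreqSymbol_atTop (ξ : E) :
    Tendsto (fun j : ℤ => lowFreqSymbol (E := E) j ξ) atTop (𝓝 1) := by
  have h0 : Tendsto (fun j : ℤ => ((2 : ℝ) ^ (-j)) • ξ) atTop (𝓝 0) := by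
    simpa using tendsto_two_zpow_neg_atTop.smul_const ξ
  have hc : Tendsto (fun j : ℤ => ((dyadicCutoff E (((2 : ℝ) ^ (-j)) • ξ) : ℝ) : ℂ)) atTop
      (𝓝 (((dyadicCutoff E (0 : E) : ℝ)) : ℂ)) :=
    ((Complex.continuous_ofReal.comp (dyadicCutoff E).continuous).tendsto 0).comp h0
  rw [dyadicCutoff_apply_of_norm_le_one (by simp)] at hc
  simpa [lowFreqSymbol] using hc

/-- `|χ(2^{-j} ξ)| ≤ 1` (`0 ≤ χ ≤ 1` for Mathlib's bump functions). [folklore] -/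
theorem norm_lowFreqSymbol_le_one (j : ℤ) (ξ : E) : ‖lowFreqSymbol (E := E) j ξ‖ ≤ 1 := by
  simp only [lowFreqSymbol, Complex.norm_real, Real.norm_eq_abs]
  rw [abs_of_nonneg (dyadicCutoff E).nonneg]
  exact (dyadicCutoff E).le_one

end LowFreqSymbol

section LowFreqCutoff

variable {E F : Type*} [NormedAddCommGroup E] [InnerProductSpace ℝ E] [FiniteDimensional ℝ E]
  [MeasurableSpace E] [BorelSpace E] [NormedAddCommGroup F] [NormedSpace ℂ F]

/-- Pointwise convergence of the cut-off test functions: `𝓕(χ(2^{-j}·) 𝓕⁻ψ)(x) → ψ(x)` as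
`j → +∞`, by dominated convergence on the Fourier side (`χ(2^{-j}ξ) 𝓕⁻ψ(ξ) → 𝓕⁻ψ(ξ)`,
dominated by `|𝓕⁻ψ| ∈ L¹`) and Fourier inversion `𝓕𝓕⁻ψ = ψ` (BCD Prop. 2.12, proof). [folklore] -/
theorem tendsto_fourier_lowFreqSymbol_smul_fourierInv (ψ : 𝓢(E, ℂ)) (x : E) :
    Tendsto (fun j : ℤ => (𝓕 (SchwartzMap.smulLeftCLM ℂ (lowFreqSymbol (E := E) j) (𝓕⁻ ψ))) x)
      atTop (𝓝 (ψ x)) := by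
  have hχ : ∀ j : ℤ, (lowFreqSymbol (E := E) j).HasTemperateGrowth :=
    hasTemperateGrowth_lowFreqSymbol
  have hlim : ψ x = 𝓕 (⇑(𝓕⁻ ψ : 𝓢(E, ℂ))) x := by
    rw [← SchwartzMap.fourier_coe, FourierTransform.fourier_fourierInv_eq]
  have hfun : ∀ j : ℤ, (𝓕 (SchwartzMap.smulLeftCLM ℂ (lowFreqSymbol (E := E) j) (𝓕⁻ ψ))) x =
      ∫ ξ, 𝐞 (-⟪ξ, x⟫) • (lowFreqSymbol j ξ * (𝓕⁻ ψ : 𝓢(E, ℂ)) ξ) := fun j => by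
    rw [SchwartzMap.fourier_coe, Real.fourier_eq]
    congr 1 with ξ
    rw [SchwartzMap.smulLeftCLM_apply_apply (hχ j), smul_eq_mul]
  rw [hlim, Real.fourier_eq]
  simp_rw [hfun]
  refine tendsto_integral_filter_of_dominated_convergence (fun ξ => ‖(𝓕⁻ ψ : 𝓢(E, ℂ)) ξ‖) ?_ ?_
    ((𝓕⁻ ψ : 𝓢(E, ℂ)).integrable.norm) ?_
  · exact Eventually.of_forall fun j => by
      have : Continuous fun ξ : E => 𝐞 (-⟪ξ, x⟫) • (lowFreqSymbol j ξ * (𝓕⁻ ψ : 𝓢(E, ℂ)) ξ) := by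
        have h1 : Continuous (lowFreqSymbol (E := E) j) := (contDiff_lowFreqSymbol j).continuous
        fun_prop
      exact this.aestronglyMeasurable
  · refine Eventually.of_forall fun j => ae_of_all _ fun ξ => ?_
    rw [Circle.norm_smul, norm_mul]
    exact mul_le_of_le_one_left (norm_nonneg _) (norm_lowFreqSymbol_le_one j ξ)
  · refine ae_of_all _ fun ξ => ?_
    have := ((tendsto_lowFreqSymbol_atTop ξ).mul_const ((𝓕⁻ ψ : 𝓢(E, ℂ)) ξ)).const_smul
      (𝐞 (-⟪ξ, x⟫))
    simpa using this

/-- Uniform bound for the cut-off test functions: `‖𝓕(χ(2^{-j}·) 𝓕⁻ψ)(x)‖ ≤ ∫ ‖𝓕⁻ψ‖`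
(`|χ| ≤ 1`). [folklore] -/
theorem norm_fourier_lowFreqSymbol_smul_fourierInv_le (ψ : 𝓢(E, ℂ)) (j : ℤ) (x : E) :
    ‖(𝓕 (SchwartzMap.smulLeftCLM ℂ (lowFreqSymbol (E := E) j) (𝓕⁻ ψ))) x‖ ≤
      ∫ ξ, ‖(𝓕⁻ ψ : 𝓢(E, ℂ)) ξ‖ := by
  rw [SchwartzMap.fourier_coe, Real.fourier_eq]
  refine (norm_integral_le_integral_norm _).trans (integral_mono_of_nonneg
    (ae_of_all _ fun ξ => norm_nonneg _) ((𝓕⁻ ψ : 𝓢(E, ℂ)).integrable.norm)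
    (ae_of_all _ fun ξ => ?_))
  simp only
  rw [Circle.norm_smul, SchwartzMap.smulLeftCLM_apply_apply (hasTemperateGrowth_lowFreqSymbol j),
    smul_eq_mul, norm_mul]
  exact mul_le_of_le_one_left (norm_nonneg _) (norm_lowFreqSymbol_le_one j ξ)

/-- Discharge of the named fact `tendsto_lowFreqCutoff_atTop` (BCD Prop. 2.12): `Ṡ_j φ → φ` in
`𝓢'(E, F)` as `j → +∞`, for every Schwartz function `φ`. In the pointwise-convergence topology of
`𝓢'` this means `⟨Ṡ_j φ, ψ⟩ → ⟨φ, ψ⟩` for each test function `ψ`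
(`PointwiseConvergenceCLM.tendsto_iff_forall_tendsto`); now
`⟨Ṡ_j φ, ψ⟩ = ∫ 𝓕(χ(2^{-j}·) 𝓕⁻ψ)(x) • φ(x) dx → ∫ ψ(x) • φ(x) dx = ⟨φ, ψ⟩` by dominated
convergence, the integrand being bounded by `‖𝓕⁻ψ‖_{L¹} ‖φ(x)‖`. [cite: BahouriCheminDanchin2011, Prop. 2.12] -/
theorem tendsto_lowFreqCutoff_atTop_holds : tendsto_lowFreqCutoff_atTop (E := E) (F := F) := by
  intro φ
  rw [PointwiseConvergenceCLM.tendsto_iff_forall_tendsto]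
  intro ψ
  rw [SchwartzMap.coe_apply]
  have happ : ∀ j : ℤ, lowFreqCutoff j (φ : 𝓢'(E, F)) ψ =
      ∫ x, (𝓕 (SchwartzMap.smulLeftCLM ℂ (lowFreqSymbol (E := E) j) (𝓕⁻ ψ))) x • φ x :=
    fun j => by
      rw [lowFreqCutoff_apply, fourierMultiplierCLM_apply_apply, SchwartzMap.coe_apply]
  simp_rw [happ]
  refine tendsto_integral_filter_of_dominated_convergence
    (fun x => (∫ ξ, ‖(𝓕⁻ ψ : 𝓢(E, ℂ)) ξ‖) * ‖φ x‖) ?_ ?_ (φ.integrable.norm.const_mul _) ?_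
  · exact Eventually.of_forall fun j =>
      ((SchwartzMap.continuous _).smul φ.continuous).aestronglyMeasurable
  · refine Eventually.of_forall fun j => ae_of_all _ fun x => ?_
    rw [norm_smul]
    exact mul_le_mul_of_nonneg_right (norm_fourier_lowFreqSymbol_smul_fourierInv_le ψ j x)
      (norm_nonneg _)
  · exact ae_of_all _ fun x =>
      (tendsto_fourier_lowFreqSymbol_smul_fourierInv ψ x).smul_const (φ x)

end LowFreqCutoff

end Literature.Analysis.FunctionSpaces
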